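import Summits.BirchSwinnertonDyer.BirchSwinnertonDyer.Theses.TwistFamilyManinDescent
import Summits.BirchSwinnertonDyer.BirchSwinnertonDyer.Theorems.KatoDescentTamePotSupersingularTameDefectIsogenyInvariance
import Summits.BirchSwinnertonDyer.Rank1Residual.Additive.GordTorsionFiveSeven
import Summits.BirchSwinnertonDyer.Rank1Residual.AdditivePotMult.PStarTwistModel
import Summits.BirchSwinnertonDyer.Rank1Residual.X2.IsogenyClassStability
import Literature.NumberTheory.EllipticCurves.VariableChangePointsMap
import Literature.NumberTheory.EllipticCurves.GlobalMinimalModelProofs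
import Literature.NumberTheory.EllipticCurves.ComplexMultiplicationBSDTripleProofs
import Literature.NumberTheory.EllipticCurves.RootNumberProofs
import HarnessLib

/-!
# Route `TwistFamilyManinDescent`, LINE 16 (bsd-idea-3 g6), item S16a `RaynaudRegimeClassNoLocalPTorsion`
# (stmt-BirchSwinnertonDyer-27295): on the Raynaud rows NO curve of the `ℚ`-isogeny class has a
# `ℚ_p`-rational point of order `p` — PROVED BY NAME from tree theorems (no stub, no named fact, no `sorry`)

Cell `pub/bsd-wall`, D-0145 line `route-BirchSwinnertonDyer-TeichmullerTwistDescent`, seat `bsd-line-ttd-p1` g7,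
working the planner-of-record's TFMD LINE 16. BSD is NOT proved by this; Manin's conjecture is not proved by this;
K15a (`SupersingularStrongIsUnstarred`, stmt-27072) and Ray57 (stmt-26325) stay open. This file closes ONLY the
support item S16a — the typed local lever that the twisted-Vatsal engine S16b
(`SupersingularKummerFreeStrongIsUnstarred`, stmt-27296) consumes.

## Statement (verbatim the route decl)

For `W/ℚ` globally minimal, `p` prime, on the rows `(p, v_p Δ_min) ∈ {(5;4),(5;8),(7;3),(7;9)}` (Kodaira IV/IV* at
`5`, III/III* at `7` once potentially good), `W` additive at `p` (`Addv W p`) and the `p*`-twist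
`W ⊗ χ_{p*}` NEITHER good NOR multiplicative at `p`: every elliptic `W'/ℚ` isogenous to `W` (any model) has
`W'(ℚ_p)[p] = 0`, i.e. `¬ ∃ P ∈ W'(ℚ_p), p • P = 0 ∧ P ≠ 0`.

## Proof (all ingredients are PROVED tree theorems)

1. `0 ≤ v_p(j(W))` (potentially good): otherwise `W` is additive potentially multiplicative at the odd `p`, and
   then `W ⊗ χ_{p*}` is MULTIPLICATIVE at `p` (b2b `AdditivePotMult.PotMult.mult_quadraticTwist_pStar`,
   Silverman *ATAEC* V.5.3 + *AEC* VII.5.1(b)), contradicting the twist hypothesis (prime/place bridge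
   `hasMultiplicativeReductionAtPrime_iff_hasMultiplicativeReductionAt_holds`).
2. The semistability defect `e(W) = 12 / gcd(12, v_p Δ_min)` is `3` at `p = 5` (`v ∈ {4, 8}`) and `4` at
   `p = 7` (`v ∈ {3, 9}`) — arithmetic on the row.
3. Pass to a globally minimal model `C • W'` of `W'` (`hasGlobalMinimalModel_rat_holds`, *AEC* VIII.8.3); it is
   isogenous to `W` (`IsIsogenous.smul_right`), additive at `p` (`X2.addv_iff_of_isIsogenous`, *AEC* VII.7.2) and
   has the SAME defect (`TameDefectIsogenyInvariance.semistabilityIndex_eq_of_isIsogenous`: `e` is a `ℚ`-isogeny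
   invariant at every potentially good `p ≥ 5`, via good reduction over a Kummer field of ramification index `e`).
   The `ℚ_p`-points are transported along the change of variables
   (`VariableChange.pointEquivBaseChange W' C ℚ_[p]`, an additive equivalence).
4. Mazur's Step 1 at the additive prime (b2b `GordTorsionFiveSeven.padicValInt_minimalDiscriminantInt_of_prime_zsmul_eq_zero_of_addv`,
   Mazur 1977 III §5 Step 1 p. 158 pushed to `p ∈ {5, 7}`): a non-zero `ℚ_p`-rational `p`-torsion point on a
   globally minimal curve additive at `p ≥ 5` forces `(p = 5 ∧ v₅ Δ_min ∈ {2, 3})` or `(p = 7 ∧ v₇ Δ_min = 2)`,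
   i.e. `e ∈ {6, 4}` at `5` or `e = 6` at `7` — contradicting step 2.

This is the LOCAL (`ℚ_p`-rational) twin of the global-torsion theorem
`TameUpperReducibleTorsionByDefect.not_dvd_torsionOrder_of_isIsogenous_of_semistabilityIndex` (cell `bsd-potss`),
whose structure it copies. The formal-group road of the item's informal (good supersingular reduction over
`ℚ_p(p^{1/e})`, `e < p − 1`, Silverman *AEC* IV.6.1) is not needed: the tree's Mazur-Step-1 theorem is sharper
and model-free in `e`.

References: [Mazur1977] B. Mazur, *Modular curves and the Eisenstein ideal*, Publ. Math. IHÉS 47 (1977), Ch. III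
§5 Step 1 (p. 158); [SilvermanAEC2009] J. H. Silverman, *The Arithmetic of Elliptic Curves*, GTM 106 (2009),
III.3.1(b), VII.5 Prop. 5.1, Prop. VII.5.5, Cor. VII.7.2, VIII.8 Cor. 8.3; [SilvermanATAEC1994] J. H. Silverman,
*Advanced Topics*, GTM 151 (1994), IV Table 4.1, V.5.3; [SerreTate1968] §2 Cor. 3; [Serre1972] §5.6 (p. 312).
Design: theorems only; no definition, no named fact, no `sorry`; axioms `propext`, `Classical.choice`, `Quot.sound`.
-/

set_option autoImplicit false
-- the Theorems directory repeats the summit name (sibling precedent `TwistFamilyManinDescentRaynaudRegimeOfOrientation.lean`)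
set_option linter.dupNamespace false

noncomputable section

open scoped Classical

namespace Summit.BirchSwinnertonDyer.BirchSwinnertonDyer.Theorems.TwistFamilyManinDescent

open WeierstrassCurve Literature.NumberTheory.EllipticCurves
  Literature.NumberTheory.EllipticCurves.Rank1Residual
  Summit.BirchSwinnertonDyer.Rank1Residual
  Summit.BirchSwinnertonDyer.Rank1Residual.Additive
  Summit.BirchSwinnertonDyer.BirchSwinnertonDyer.Theorems.TameDefectIsogenyInvariance

/-! ## §1 The twist hypothesis of the Raynaud rows means: potentially good -/

section PotGood

variable {W : WeierstrassCurve ℚ} [W.IsElliptic] {p : ℕ} [hp : Fact p.Prime]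

/-- **`W ⊗ χ_{p*}` neither good nor multiplicative at an additive odd `p` ⟹ `0 ≤ v_p(j(W))`.** Were
`v_p(j) < 0` (additive potentially multiplicative), the `p*`-twist would be MULTIPLICATIVE at `p`
(b2b `AdditivePotMult.PotMult.mult_quadraticTwist_pStar`; Silverman *ATAEC* V.5.3, *AEC* VII.5.1(b)), which the
hypothesis forbids (place form through `hasMultiplicativeReductionAtPrime_iff_hasMultiplicativeReductionAt_holds`).
[cite: SilvermanATAEC1994, V.5.3] [cite: SilvermanAEC2009, VII.5 Prop. 5.1(b) and Prop. VII.5.5] -/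
theorem padicValRat_j_nonneg_of_addv_of_not_semistable_quadraticTwist_pStar (hp2 : p ≠ 2)
    (hadd : Addv W p)
    (htw : ¬ ((W.quadraticTwist (((-1 : ℤ) ^ (p / 2) * p : ℤ) : ℚ)).HasGoodReductionAt
          ((Rat.HeightOneSpectrum.primesEquiv (R := ℤ)).symm ⟨p, hp.out⟩) ∨
        (W.quadraticTwist (((-1 : ℤ) ^ (p / 2) * p : ℤ) : ℚ)).HasMultiplicativeReductionAt
          ((Rat.HeightOneSpectrum.primesEquiv (R := ℤ)).symm ⟨p, hp.out⟩))) :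
    0 ≤ padicValRat p W.j := by
  by_contra hj
  push Not at hj
  have hpm : AdditivePotMult.PotMult W p := ⟨hadd, hj⟩
  have hm : Mult (W.quadraticTwist ((-1 : ℚ) ^ (p / 2) * p)) p :=
    hpm.mult_quadraticTwist_pStar hp2
  have hcast : (((-1 : ℤ) ^ (p / 2) * p : ℤ) : ℚ) = (-1 : ℚ) ^ (p / 2) * p := by push_cast; ring
  have hd0 : ((-1 : ℚ) ^ (p / 2) * p) ≠ 0 :=
    mul_ne_zero (pow_ne_zero _ (by norm_num)) (Nat.cast_ne_zero.mpr hp.out.ne_zero)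
  haveI : (W.quadraticTwist ((-1 : ℚ) ^ (p / 2) * p)).IsElliptic := W.isElliptic_quadraticTwist hd0
  have hm' : (W.quadraticTwist ((-1 : ℚ) ^ (p / 2) * p)).HasMultiplicativeReductionAt
      ((Rat.HeightOneSpectrum.primesEquiv (R := ℤ)).symm ⟨p, hp.out⟩) :=
    ((W.quadraticTwist ((-1 : ℚ) ^ (p / 2) * p)
      ).hasMultiplicativeReductionAtPrime_iff_hasMultiplicativeReductionAt_holds ⟨p, hp.out⟩).mp hm
  rw [hcast] at htw
  exact htw (Or.inr hm')

end PotGood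

/-! ## §2 The defect on the Raynaud rows, and `ℚ_p`-rational `p`-torsion on the class read off the defect -/

section Defect

variable {W : WeierstrassCurve ℚ} [W.IsElliptic] [W.IsGloballyMinimal] {p : ℕ} [hp : Fact p.Prime]

omit [W.IsElliptic] in
/-- **The Raynaud rows have defect `e = 3` at `5` (`v₅ Δ_min ∈ {4, 8}`: IV/IV*) and `e = 4` at `7`
(`v₇ Δ_min ∈ {3, 9}`: III/III*)** — `e = 12 / gcd(12, v)`. [cite: Serre1972, §5.6 (p. 312)]
[cite: SilvermanATAEC1994, IV Table 4.1 (PDF p. 365)] -/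
theorem semistabilityIndex_of_raynaudRow
    (hrow : (p = 5 ∧ padicValInt 5 W.minimalDiscriminantInt ∈ ({4, 8} : Finset ℕ)) ∨
      (p = 7 ∧ padicValInt 7 W.minimalDiscriminantInt ∈ ({3, 9} : Finset ℕ))) :
    (p = 5 ∧ semistabilityIndex W p = 3) ∨ (p = 7 ∧ semistabilityIndex W p = 4) := by
  unfold semistabilityIndex
  rcases hrow with ⟨rfl, h⟩ | ⟨rfl, h⟩
  · refine Or.inl ⟨rfl, ?_⟩
    simp only [Finset.mem_insert, Finset.mem_singleton] at h
    rcases h with h | h <;> rw [h] <;> decide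
  · refine Or.inr ⟨rfl, ?_⟩
    simp only [Finset.mem_insert, Finset.mem_singleton] at h
    rcases h with h | h <;> rw [h] <;> decide

/-- **`ℚ_p`-rational `p`-torsion somewhere in an additive potentially good class at `p ≥ 5` forces
`(p = 5 ∧ e ∈ {4, 6}) ∨ (p = 7 ∧ e = 6)`**, `e` the defect of ANY globally minimal member — LOCAL twin of
`TameUpperReducibleTorsionByDefect.not_dvd_torsionOrder_of_isIsogenous_of_semistabilityIndex`. Contrapositive
form: if `p = 5 → e ∉ {4, 6}` and `p = 7 → e ≠ 6` then for EVERY elliptic `W'` (any model) `ℚ`-isogenous to `W`,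
every `P ∈ W'(ℚ_p)` with `p • P = 0` is `0`. Proof: a globally minimal model `C • W'` (*AEC* VIII.8.3) is
additive at `p` (*AEC* VII.7.2) with the SAME defect (`semistabilityIndex_eq_of_isIsogenous`); the point is
carried to `(C • W')(ℚ_p)` by the change of variables (`VariableChange.pointEquivBaseChange`, *AEC* III.3.1(b));
Mazur's Step 1 at the additive prime (`padicValInt_minimalDiscriminantInt_of_prime_zsmul_eq_zero_of_addv`) leaves
only `v₅ Δ_min ∈ {2, 3}` (`e ∈ {6, 4}`) or `v₇ Δ_min = 2` (`e = 6`). UNCONDITIONAL.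
[cite: Mazur1977, Ch. III §5, Step 1, p. 158] [cite: SilvermanAEC2009, III.3.1(b), Cor. VII.7.2, VIII.8 Cor. 8.3]
[cite: SilvermanATAEC1994, IV Table 4.1 (PDF p. 365)] -/
theorem padicPoint_eq_zero_of_isIsogenous_of_semistabilityIndex (hp5 : 5 ≤ p) (hadd : Addv W p)
    (hj : 0 ≤ padicValRat p W.j)
    (h5 : p = 5 → semistabilityIndex W p ≠ 4 ∧ semistabilityIndex W p ≠ 6)
    (h7 : p = 7 → semistabilityIndex W p ≠ 6)
    {W' : WeierstrassCurve ℚ} [W'.IsElliptic] (hiso : IsIsogenous W W')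
    (P : (W'.baseChange ℚ_[p]).toAffine.Point) (hP : p • P = 0) : P = 0 := by
  obtain ⟨C, hC⟩ := hasGlobalMinimalModel_rat_holds W'
  haveI := hC
  have hiso' : IsIsogenous W (C • W') := hiso.smul_right C
  have hadd' : Addv (C • W') p := (X2.addv_iff_of_isIsogenous (p := p) hiso').mp hadd
  have he : semistabilityIndex (C • W') p = semistabilityIndex W p :=
    semistabilityIndex_eq_of_isIsogenous hp5 hj hiso'
  -- the defect of the minimal member, read off `ord_p Δ_min`
  have hofv : ∀ v : ℕ, padicValInt p (C • W').minimalDiscriminantInt = v →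
      semistabilityIndex W p = 12 / Nat.gcd 12 v := by
    intro v hv
    rw [← he]
    unfold semistabilityIndex
    rw [hv]
  -- transport the point to the minimal model
  set Q : ((C • W').baseChange ℚ_[p]).toAffine.Point :=
    VariableChange.pointEquivBaseChange W' C ℚ_[p] P with hQ
  have hQp : (p : ℤ) • Q = 0 := by
    rw [natCast_zsmul, hQ, ← map_nsmul, hP, map_zero]
  by_contra hP0
  have hQ0 : Q ≠ 0 := by
    rw [hQ]
    exact (AddEquiv.map_ne_zero_iff _).mpr hP0
  rcases padicValInt_minimalDiscriminantInt_of_prime_zsmul_eq_zero_of_addv (C • W') p hp5 hadd' hQ0 hQp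
    with ⟨hp5', hv | hv⟩ | ⟨hp7, hv⟩
  · exact (h5 hp5').2 ((hofv 2 hv).trans (by decide))
  · exact (h5 hp5').1 ((hofv 3 hv).trans (by decide))
  · exact h7 hp7 ((hofv 2 hv).trans (by decide))

/-- **An `e = 3` class (Kodaira IV/IV*) has NO member with a `ℚ_p`-rational point of order `p`** at any additive
potentially good `p ≥ 5`; any model of the member. UNCONDITIONAL.
[cite: Mazur1977, Ch. III §5, Step 1, p. 158] [cite: SilvermanATAEC1994, IV Table 4.1 (PDF p. 365)] -/
theorem padicPoint_eq_zero_of_isIsogenous_of_semistabilityIndex_eq_three (hp5 : 5 ≤ p)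
    (hadd : Addv W p) (hj : 0 ≤ padicValRat p W.j) (he : semistabilityIndex W p = 3)
    {W' : WeierstrassCurve ℚ} [W'.IsElliptic] (hiso : IsIsogenous W W')
    (P : (W'.baseChange ℚ_[p]).toAffine.Point) (hP : p • P = 0) : P = 0 :=
  padicPoint_eq_zero_of_isIsogenous_of_semistabilityIndex hp5 hadd hj (fun _ ↦ by omega)
    (fun _ ↦ by omega) hiso P hP

/-- **An `e = 4` class (Kodaira III/III*) at an additive potentially good `p ≥ 7` has NO member with a
`ℚ_p`-rational point of order `p`** (at `p = 5`, `e = 4` is the Kosters–Pannekoek corner III@5 and the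
statement is false: excluded by `p ≠ 5`). UNCONDITIONAL.
[cite: Mazur1977, Ch. III §5, Step 1, p. 158] [cite: SilvermanATAEC1994, IV Table 4.1 (PDF p. 365)] -/
theorem padicPoint_eq_zero_of_isIsogenous_of_semistabilityIndex_eq_four (hp5 : 5 ≤ p) (hp5' : p ≠ 5)
    (hadd : Addv W p) (hj : 0 ≤ padicValRat p W.j) (he : semistabilityIndex W p = 4)
    {W' : WeierstrassCurve ℚ} [W'.IsElliptic] (hiso : IsIsogenous W W')
    (P : (W'.baseChange ℚ_[p]).toAffine.Point) (hP : p • P = 0) : P = 0 :=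
  padicPoint_eq_zero_of_isIsogenous_of_semistabilityIndex hp5 hadd hj (fun h ↦ absurd h hp5')
    (fun _ ↦ by omega) hiso P hP

end Defect

/-! ## §3 The item: S16a `RaynaudRegimeClassNoLocalPTorsion` (stmt-BirchSwinnertonDyer-27295), by name -/

/-- **S16a (LINE 16, stmt-BirchSwinnertonDyer-27295) `RaynaudRegimeClassNoLocalPTorsion` — PROVED.** On the
Raynaud rows `(5; v₅ Δ_min ∈ {4, 8})`, `(7; v₇ Δ_min ∈ {3, 9})`, `W` globally minimal and additive at `p` with
`W ⊗ χ_{p*}` neither good nor multiplicative at `p`: NO elliptic curve `ℚ`-isogenous to `W` has a `ℚ_p`-rational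
point of order `p`. Composition of §1 (`0 ≤ v_p j`), §2 (`e = 3` at `5`, `e = 4` at `7`; class transport of `e`
and of additivity to a globally minimal model of the member; Mazur's Step 1 at the additive prime). The
formal-group argument over `ℚ_p(p^{1/e})` of the item's informal is not needed. No summit, rung, crux or BSD
statement is proved by this; K15a/Ray57 stay open. [cite: Mazur1977, Ch. III §5, Step 1, p. 158]
[cite: SilvermanAEC2009, III.3.1(b), VII.5 Prop. 5.1, Prop. VII.5.5, Cor. VII.7.2, VIII.8 Cor. 8.3]
[cite: SilvermanATAEC1994, IV Table 4.1 (PDF p. 365), V.5.3] -/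
theorem raynaudRegimeClassNoLocalPTorsion_proof :
    Summit.BirchSwinnertonDyer.BirchSwinnertonDyer.Theses.TwistFamilyManinDescent.RaynaudRegimeClassNoLocalPTorsion := by
  intro W _ _ p hp hrow hadd htw W' _ hiso
  rintro ⟨P, hP, hP0⟩
  have hp57 : p = 5 ∨ p = 7 := hrow.elim (fun h ↦ Or.inl h.1) (fun h ↦ Or.inr h.1)
  have hp5 : 5 ≤ p := by rcases hp57 with rfl | rfl <;> norm_num
  have hp2 : p ≠ 2 := by omega
  have hj : 0 ≤ padicValRat p W.j :=
    padicValRat_j_nonneg_of_addv_of_not_semistable_quadraticTwist_pStar hp2 hadd htw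
  rcases semistabilityIndex_of_raynaudRow hrow with ⟨h5, he⟩ | ⟨h7, he⟩
  · exact hP0 (padicPoint_eq_zero_of_isIsogenous_of_semistabilityIndex_eq_three hp5 hadd hj he hiso P hP)
  · exact hP0 (padicPoint_eq_zero_of_isIsogenous_of_semistabilityIndex_eq_four hp5 (by omega) hadd hj he
      hiso P hP)

end Summit.BirchSwinnertonDyer.BirchSwinnertonDyer.Theorems.TwistFamilyManinDescent

end
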